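/-
Copyright (c) 2026 the pub-hodgecm-mathlib formalisation cell (harness21).  Prover seat hodgecm-mathlib-LH5-p02 (g11): E1 row 41c R-c «FINITE CARRIER OF `V^K` +
NBHD-BASIS ⇒ AUXILIARY `K`» (E1 keeper ∕ dealer F0P3a-p03 (g29); census row 38 «(SS-K) VIA THE RESOLUTION» F0P3a-p04 (g31) §3 (A1)(b–d), (A3), §5 R-c), 2026-09-03.
-/
import Literature.NumberTheory.Automorphic.SmoothFixedVectorGeneration   -- ★ row 23 (this seat): `iSup_fixedPoints_eq_top_of_equivariant`, `iSup_fixedPoints_eq_top_of_forall_exists_le`; brings `Representation.fixedPoints` ∕ `IsAdmissible`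
import Literature.NumberTheory.Automorphic.CompactOpenNormalCore          -- ★ `Subgroup.coreIn` + `isOpen_coreIn` ∕ `isCompact_coreIn` ∕ `conj_mem_coreIn` ∕ `coreIn_le_left` ∕ `coreIn_le_right`
import Mathlib.Topology.Algebra.Nonarchimedean.Basic
import Mathlib.RingTheory.Finiteness.Basic
import Mathlib.LinearAlgebra.Finsupp.Span
import HarnessLib

/-!
# The finite carrier of `V^K` in `⨆_x V^{U_x}`; the auxiliary compact open subgroup of Korman's Claim 39

Topic `NumberTheory/Automorphic` (declarations in Mathlib's `Submodule` ∕ `Subgroup` ∕ `Representation` namespaces as deliberate dot-notation extensions;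
THEOREMS ONLY — no definition, instance, notation or named fact).  Cell `pub/hodgecm-mathlib` (D-0151), crux H413 = `stmt-HodgeConjecture-24833`, lane `--supports`;
E1 census row 38 «(SS-K) VIA THE RESOLUTION» (F0P3a-p04 (g31)) §3 arrows (A3) and (A1)(b)–(d), §5 row R-c.  Count-neutral generic base layer of the Schneider–Stuhler ∕ Korman
character computation; HC_CM is proved only modulo the 7 printed citations (2 remaining named inputs: hLiu418 = `stmt-HodgeConjecture-24832`, h413 =
`stmt-HodgeConjecture-24833`) until rung 0 closes.

* §1 (A3) FINITE CARRIER.  A finitely generated submodule of `⨆_i N_i` lies in `⨆_{i ∈ S₀} N_i` for a FINITE `S₀` (`Submodule.FG.exists_finset_le_biSup`, Mathlib's compact-element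
  lemma); hence for a representation `ρ` whose `K`-fixed vectors `V^K` are finitely generated (e.g. `ρ` admissible, `K` compact open) and a family of subgroups with `⨆_x V^{U_x} = V`
  (★ row 23: `ρ` irreducible with one `V^{U_{x₀}} ≠ 0` and `U` conjugation-equivariant), **`V^K ≤ ⨆_{x ∈ S₀} V^{U_x}`** for a finite `S₀`, which may be taken to contain any prescribed
  finite set (`exists_finset_fixedPoints_le_biSup`, `…_superset`, `…_of_isAdmissible`, `…_of_equivariant`).  [Schneider–Stuhler 1997 §III.4; Korman 2004 §5 (the finite subtree
  carrying `V^K`)].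
* §2 (A1)(b)–(d) THE AUXILIARY GROUP.  In a topological group, inside a COMPACT OPEN subgroup `P` and below finitely many open subgroups (and, in a non-archimedean group, inside any
  neighbourhood of `1`) there is a compact open subgroup `K` NORMALISED BY `P` — the normal core ★ `Subgroup.coreIn` of the intersection (`Subgroup.exists_isOpen_le_coreIn_of_finite`,
  `…_of_mem_nhds`); packaged with an element `γ ∈ P` and a function `Θ` locally constant at `γ`: **`K` open compact, `K ≤ P`, `K ≤ W` for all `W ∈ 𝒲`, `γKγ⁻¹ = K`, `Θ` constant on
  `γK`** (`Subgroup.exists_aux_subgroup_of_eventually_eq`) — Korman's Claim 39 (a)–(d) with the vertex∕edge groups `U_x^{(e)}` (`x ∈ X^γ`) and the stabilisers `P_y` (`y ∈ X^γ ∪ N(X^γ)`)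
  as the finite family `𝒲`.  [Korman 2004 Claim 39; Schneider–Stuhler 1997 III.4.10–4.12; Meyer–Solleveld 2010 §2].

## References
* [SchneiderStuhler1997] P. Schneider, U. Stuhler, *Representation theory and sheaves on the Bruhat–Tits building*, Publ. Math. IHÉS 85 (1997), §III.4 (Lemma III.4.10–4.12: the
  character on the elliptic set through the fixed subcomplex).
* [Korman2004] J. Korman, *On the character of an admissible representation of a reductive p-adic group* (arXiv:math/0409292), §5 Lemma 38, Claim 39 (the auxiliary compact open
  subgroup and the finite subtree).
* [BernsteinZelevinsky1976] I. N. Bernstein, A. V. Zelevinsky, *Representations of the group `GL(n,F)`*, Russian Math. Surveys 31 (1976), §2.1 (admissibility: `dim V^K < ∞`).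
-/

set_option autoImplicit false

open Topology Filter

/-! ## §1 (A3) The finite carrier of a finitely generated submodule of `⨆_i N_i` -/

namespace Submodule

variable {R M : Type*} [Semiring R] [AddCommMonoid M] [Module R M]

/-- **A finitely generated submodule of `⨆_i N_i` lies in a FINITE partial supremum `⨆_{i ∈ s} N_i`** (finitely generated = compact element of the submodule lattice, Mathlib
`Submodule.fg_iff_compact` + `CompleteLattice.IsCompactElement.exists_finset_of_le_iSup`; the one-vector case is Mathlib `Submodule.exists_finset_of_mem_iSup`).
[cite: SchneiderStuhler1997, §III.4] -/
theorem FG.exists_finset_le_biSup {ι : Type*} {W : Submodule R M} (hW : W.FG) (N : ι → Submodule R M) (h : W ≤ ⨆ i, N i) :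
    ∃ s : Finset ι, W ≤ ⨆ i ∈ s, N i :=
  CompleteLattice.IsCompactElement.exists_finset_of_le_iSup (Submodule R M) ((fg_iff_compact W).1 hW) N h

/-- The finite index set may be taken to CONTAIN any prescribed finite set `F` (enlarge `s` to `s ∪ F`). [cite: SchneiderStuhler1997, §III.4] -/
theorem FG.exists_finset_superset_le_biSup {ι : Type*} [DecidableEq ι] {W : Submodule R M} (hW : W.FG) (N : ι → Submodule R M) (h : W ≤ ⨆ i, N i)
    (F : Finset ι) : ∃ s : Finset ι, F ⊆ s ∧ W ≤ ⨆ i ∈ s, N i := by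
  obtain ⟨s, hs⟩ := hW.exists_finset_le_biSup N h
  refine ⟨s ∪ F, Finset.subset_union_right, hs.trans ?_⟩
  exact biSup_mono fun i hi => Finset.mem_union_left F hi

end Submodule

namespace Representation

section Carrier

variable {k G V : Type*} [CommRing k] [Group G] [AddCommGroup V] [Module k V] (ρ : Representation k G V)

/-- **(A3) THE FINITE CARRIER OF `V^K`**: if `V^K` is finitely generated and `⨆_x V^{U_x} = V`, then `V^K ≤ ⨆_{x ∈ S₀} V^{U_x}` for some FINITE `S₀` — a basis of `V^K` is carried by
finitely many `V^{U_x}` (★ row 23 `exists_finsupp_mem_fixedPoints_sum_eq` vector by vector).  Census row 38 (A3) signature (with `Module.Finite` for `FiniteDimensional`, same term over a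
field). [cite: SchneiderStuhler1997, §III.4] [cite: Korman2004, §5 Claim 39] -/
theorem exists_finset_fixedPoints_le_biSup {ι : Type*} (K : Subgroup G) (U : ι → Subgroup G) (hfd : Module.Finite k (ρ.fixedPoints K))
    (hgen : ⨆ x, ρ.fixedPoints (U x) = ⊤) : ∃ S₀ : Finset ι, ρ.fixedPoints K ≤ ⨆ x ∈ S₀, ρ.fixedPoints (U x) :=
  (Module.Finite.iff_fg.1 hfd).exists_finset_le_biSup _ (hgen ▸ le_top)

/-- (A3) with the carrier containing a prescribed finite set `F` (e.g. the fixed vertices `X^γ`). [cite: SchneiderStuhler1997, §III.4] [cite: Korman2004, §5 Claim 39] -/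
theorem exists_finset_superset_fixedPoints_le_biSup {ι : Type*} [DecidableEq ι] (K : Subgroup G) (U : ι → Subgroup G) (hfd : Module.Finite k (ρ.fixedPoints K))
    (hgen : ⨆ x, ρ.fixedPoints (U x) = ⊤) (F : Finset ι) : ∃ S₀ : Finset ι, F ⊆ S₀ ∧ ρ.fixedPoints K ≤ ⨆ x ∈ S₀, ρ.fixedPoints (U x) :=
  (Module.Finite.iff_fg.1 hfd).exists_finset_superset_le_biSup _ (hgen ▸ le_top) F

/-- (A3) for an ADMISSIBLE representation and a compact open `K` (`V^K` is then finitely generated by definition of admissibility).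
[cite: BernsteinZelevinsky1976, §2.1] [cite: SchneiderStuhler1997, §III.4] -/
theorem exists_finset_fixedPoints_le_biSup_of_isAdmissible [TopologicalSpace G] {ι : Type*} (hadm : ρ.IsAdmissible) (K : OpenSubgroup G)
    (hK : IsCompact (K : Set G)) (U : ι → Subgroup G) (hgen : ⨆ x, ρ.fixedPoints (U x) = ⊤) :
    ∃ S₀ : Finset ι, ρ.fixedPoints (K : Subgroup G) ≤ ⨆ x ∈ S₀, ρ.fixedPoints (U x) :=
  ρ.exists_finset_fixedPoints_le_biSup (K : Subgroup G) U (hadm.finite_fixedPoints K hK) hgen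

/-- Monotonicity of the finite carrier: `⨆_{x ∈ S₀} V^{U_x} ≤ ⨆_{x ∈ S₁} V^{U_x}` for `S₀ ⊆ S₁` (used when the carrier is enlarged to a ball around the base vertex).
[cite: SchneiderStuhler1997, §III.4] -/
theorem biSup_fixedPoints_mono {ι : Type*} (U : ι → Subgroup G) {S₀ S₁ : Finset ι} (h : S₀ ⊆ S₁) :
    ⨆ x ∈ S₀, ρ.fixedPoints (U x) ≤ ⨆ x ∈ S₁, ρ.fixedPoints (U x) :=
  biSup_mono fun _ hx => h hx

end Carrier

section Irreducible

variable {k G V : Type*} [Field k] [Group G] [AddCommGroup V] [Module k V] (ρ : Representation k G V)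

/-- **(A3) ON THE BUILDING**: `ρ` irreducible, `G` acting on `X` with conjugation-equivariant level groups `U (g • x) = g (U x) g⁻¹`, one `V^{U x₀} ≠ 0` (so `⨆_x V^{U_x} = V` by ★ row 23
`iSup_fixedPoints_eq_top_of_equivariant`) and `V^K` finitely generated: `V^K` is carried by FINITELY many vertices, containing any prescribed finite `F ⊆ X`.
[cite: SchneiderStuhler1997, §III.4] [cite: Korman2004, §5 Claim 39] -/
theorem exists_finset_superset_fixedPoints_le_biSup_of_equivariant {X : Type*} [DecidableEq X] [MulAction G X] (U : X → Subgroup G)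
    (hU : ∀ (g : G) (x : X), U (g • x) = (U x).map (MulAut.conj g).toMonoidHom) (x₀ : X) [ρ.IsIrreducible] (hne : ρ.fixedPoints (U x₀) ≠ ⊥)
    (K : Subgroup G) (hfd : Module.Finite k (ρ.fixedPoints K)) (F : Finset X) :
    ∃ S₀ : Finset X, F ⊆ S₀ ∧ ρ.fixedPoints K ≤ ⨆ x ∈ S₀, ρ.fixedPoints (U x) :=
  ρ.exists_finset_superset_fixedPoints_le_biSup K U hfd (ρ.iSup_fixedPoints_eq_top_of_equivariant U hU x₀ hne) F

/-- (A3) for an irreducible `ρ` and a family through which every conjugate of `K₁` factors (`∀ g, ∃ x, U x ≤ gK₁g⁻¹`), `V^{K₁} ≠ 0`, `V^K` finitely generated.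
[cite: SchneiderStuhler1997, §III.4] -/
theorem exists_finset_fixedPoints_le_biSup_of_forall_exists_le {ι : Type*} (K₁ : Subgroup G) (U : ι → Subgroup G)
    (hU : ∀ g : G, ∃ x, U x ≤ K₁.map (MulAut.conj g).toMonoidHom) [ρ.IsIrreducible] (hne : ρ.fixedPoints K₁ ≠ ⊥)
    (K : Subgroup G) (hfd : Module.Finite k (ρ.fixedPoints K)) :
    ∃ S₀ : Finset ι, ρ.fixedPoints K ≤ ⨆ x ∈ S₀, ρ.fixedPoints (U x) :=
  ρ.exists_finset_fixedPoints_le_biSup K U hfd (ρ.iSup_fixedPoints_eq_top_of_forall_exists_le K₁ U hU hne)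

end Irreducible

end Representation

/-! ## §2 (A1)(b)–(d) The auxiliary compact open subgroup normalised by `P` -/

namespace Subgroup

variable {G : Type*} [Group G] [TopologicalSpace G]

/-- The intersection of a FINITE family of open subgroups is open. [cite: SchneiderStuhler1997, §III.4] -/
theorem isOpen_biInf_of_finite {𝒲 : Set (Subgroup G)} (h𝒲 : 𝒲.Finite) (ho : ∀ W ∈ 𝒲, IsOpen (W : Set G)) :
    IsOpen ((⨅ W ∈ 𝒲, W : Subgroup G) : Set G) := by
  have : ((⨅ W ∈ 𝒲, W : Subgroup G) : Set G) = ⋂ W ∈ 𝒲, (W : Set G) := by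
    simp only [Subgroup.coe_iInf]
  rw [this]
  exact h𝒲.isOpen_biInter ho

/-- **THE AUXILIARY GROUP, core form**: inside a COMPACT OPEN subgroup `P` and below every member of a FINITE family `𝒲` of open subgroups there is a COMPACT OPEN subgroup `K`
NORMALISED BY `P` — the normal core ★ `Subgroup.coreIn` of `P ∩ ⋂ 𝒲` in `P` (a neighbourhood basis of `1` in `P` by open NORMAL subgroups).
[cite: Korman2004, §5 Claim 39] [cite: SchneiderStuhler1997, §III.4] -/
theorem exists_isOpen_le_forall_le_conj_mem_of_finite [IsTopologicalGroup G] (P : Subgroup G) (hPo : IsOpen (P : Set G)) (hPc : IsCompact (P : Set G))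
    {𝒲 : Set (Subgroup G)} (h𝒲 : 𝒲.Finite) (ho : ∀ W ∈ 𝒲, IsOpen (W : Set G)) :
    ∃ K : Subgroup G, IsOpen (K : Set G) ∧ IsCompact (K : Set G) ∧ K ≤ P ∧ (∀ W ∈ 𝒲, K ≤ W) ∧ ∀ p ∈ P, ∀ c ∈ K, p * c * p⁻¹ ∈ K := by
  refine ⟨P.coreIn (⨅ W ∈ 𝒲, W), isOpen_coreIn hPc hPo (isOpen_biInf_of_finite h𝒲 ho), isCompact_coreIn hPc hPo (isOpen_biInf_of_finite h𝒲 ho),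
    coreIn_le_left _ _, fun W hW => (coreIn_le_right _ _).trans (biInf_le _ hW), fun p hp c hc => conj_mem_coreIn hp hc⟩

/-- **THE AUXILIARY GROUP inside a neighbourhood of `1`** (non-archimedean `G`): as above, and moreover `K ⊆ T` for any prescribed `T ∈ 𝓝 1` (shrink `T` to an open subgroup first,
Mathlib `NonarchimedeanGroup.is_nonarchimedean`). [cite: Korman2004, §5 Claim 39] [cite: SchneiderStuhler1997, §III.4] -/
theorem exists_isOpen_le_forall_le_conj_mem_of_mem_nhds [NonarchimedeanGroup G] (P : Subgroup G) (hPo : IsOpen (P : Set G)) (hPc : IsCompact (P : Set G))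
    {𝒲 : Set (Subgroup G)} (h𝒲 : 𝒲.Finite) (ho : ∀ W ∈ 𝒲, IsOpen (W : Set G)) {T : Set G} (hT : T ∈ 𝓝 (1 : G)) :
    ∃ K : Subgroup G, IsOpen (K : Set G) ∧ IsCompact (K : Set G) ∧ K ≤ P ∧ (∀ W ∈ 𝒲, K ≤ W) ∧ (K : Set G) ⊆ T ∧ ∀ p ∈ P, ∀ c ∈ K, p * c * p⁻¹ ∈ K := by
  obtain ⟨N, hN⟩ := NonarchimedeanGroup.is_nonarchimedean T hT
  obtain ⟨K, hKo, hKc, hKP, hKW, hKn⟩ := exists_isOpen_le_forall_le_conj_mem_of_finite P hPo hPc (h𝒲.insert (N : Subgroup G))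
    (by rintro W (rfl | hW); exacts [N.isOpen, ho W hW])
  exact ⟨K, hKo, hKc, hKP, fun W hW => hKW W (Set.mem_insert_of_mem _ hW), fun x hx => hN (hKW _ (Set.mem_insert _ _) hx), hKn⟩

/-- Local constancy at `γ` as a neighbourhood of `1`: if `Θ g = Θ γ` eventually near `γ` then `{t | Θ (γ t) = Θ γ} ∈ 𝓝 1`. [cite: Korman2004, §5 Claim 39] -/
theorem setOf_apply_mul_eq_mem_nhds_one [ContinuousMul G] {A : Type*} {Θ : G → A} {γ : G} (hΘ : ∀ᶠ g in 𝓝 γ, Θ g = Θ γ) :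
    {t : G | Θ (γ * t) = Θ γ} ∈ 𝓝 (1 : G) := by
  have hcont : Continuous fun t : G => γ * t := continuous_const.mul continuous_id
  have hc : Tendsto (fun t : G => γ * t) (𝓝 1) (𝓝 γ) := hcont.tendsto' 1 γ (mul_one γ)
  exact hc.eventually hΘ

/-- **KORMAN'S CLAIM 39 (a)–(d), generic supply** (non-archimedean `G`): for a compact open `P ∋ γ`, a finite family `𝒲` of open subgroups (the level groups `U_x^{(e)}`, `x ∈ X^γ`,
and the stabilisers `P_y`, `y ∈ X^γ ∪ N(X^γ)`) and `Θ` locally constant at `γ`, there is a COMPACT OPEN `K ≤ P` with (a) `γKγ⁻¹ ⊆ K`, (b) `Θ` constant on `γK`, (c)∕(d) `K ≤ W`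
for all `W ∈ 𝒲`, and `K` normalised by all of `P`. [cite: Korman2004, §5 Claim 39] [cite: SchneiderStuhler1997, §III.4] -/
theorem exists_aux_subgroup_of_eventually_eq [NonarchimedeanGroup G] (P : Subgroup G) (hPo : IsOpen (P : Set G)) (hPc : IsCompact (P : Set G)) {γ : G} (hγ : γ ∈ P)
    {𝒲 : Set (Subgroup G)} (h𝒲 : 𝒲.Finite) (ho : ∀ W ∈ 𝒲, IsOpen (W : Set G)) {A : Type*} {Θ : G → A} (hΘ : ∀ᶠ g in 𝓝 γ, Θ g = Θ γ) :
    ∃ K : Subgroup G, IsOpen (K : Set G) ∧ IsCompact (K : Set G) ∧ K ≤ P ∧ (∀ W ∈ 𝒲, K ≤ W) ∧ (∀ c ∈ K, γ * c * γ⁻¹ ∈ K) ∧ (∀ c ∈ K, Θ (γ * c) = Θ γ) ∧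
      ∀ p ∈ P, ∀ c ∈ K, p * c * p⁻¹ ∈ K := by
  obtain ⟨K, hKo, hKc, hKP, hKW, hKT, hKn⟩ := exists_isOpen_le_forall_le_conj_mem_of_mem_nhds P hPo hPc h𝒲 ho (setOf_apply_mul_eq_mem_nhds_one hΘ)
  exact ⟨K, hKo, hKc, hKP, hKW, fun c hc => hKn γ hγ c hc, fun c hc => hKT hc, hKn⟩

/-- Indexed form of the family clause: for `U : ι → Subgroup G` and a finite `S : Finset ι` of open `U x`, the auxiliary `K` lies below every `U x`, `x ∈ S` (take `𝒲 := U '' S`).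
[cite: Korman2004, §5 Claim 39] -/
theorem exists_aux_subgroup_of_eventually_eq_finset [NonarchimedeanGroup G] (P : Subgroup G) (hPo : IsOpen (P : Set G)) (hPc : IsCompact (P : Set G)) {γ : G} (hγ : γ ∈ P)
    {ι : Type*} (U : ι → Subgroup G) (S : Finset ι) (ho : ∀ x ∈ S, IsOpen (U x : Set G)) {A : Type*} {Θ : G → A} (hΘ : ∀ᶠ g in 𝓝 γ, Θ g = Θ γ) :
    ∃ K : Subgroup G, IsOpen (K : Set G) ∧ IsCompact (K : Set G) ∧ K ≤ P ∧ (∀ x ∈ S, K ≤ U x) ∧ (∀ c ∈ K, γ * c * γ⁻¹ ∈ K) ∧ (∀ c ∈ K, Θ (γ * c) = Θ γ) ∧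
      ∀ p ∈ P, ∀ c ∈ K, p * c * p⁻¹ ∈ K := by
  obtain ⟨K, hKo, hKc, hKP, hKW, hKγ, hKΘ, hKn⟩ := exists_aux_subgroup_of_eventually_eq P hPo hPc hγ ((S.finite_toSet).image U)
    (by rintro _ ⟨x, hx, rfl⟩; exact ho x hx) hΘ
  exact ⟨K, hKo, hKc, hKP, fun x hx => hKW _ ⟨x, hx, rfl⟩, hKγ, hKΘ, hKn⟩

end Subgroup
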